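import Literature.NumberTheory.EllipticCurves.BSDSelmerParityDokchitserBaseChangeProofs
import Literature.NumberTheory.EllipticCurves.EmertonPollackWeston2006.NearlyOrdinaryAlgebraicTransfer
import Literature.NumberTheory.GaloisRepresentations.QuadraticCharacterInertiaKummer
import Literature.NumberTheory.GaloisRepresentations.KummerQuadraticCharacterInertia
import Literature.NumberTheory.GaloisRepresentations.HeckeCharacterProofs
import HarnessLib

/-!
# Ramified ordinary lines by QUADRATIC-TWIST TRANSPORT of a Greenberg local datum at the `p^∞` level
# (cell `b2b-bsdres`, team n1011, seat p07 (gen 4), row TB-ROL FILE A — generic, fact-free)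

HONEST FRAMING (cell `b2b-bsdres`, run/shared/lean/b2b/bsd-rank1-residual/, verbatim in every
file): the goal of the cell is to DELETE the COMBINATION-SHAPED residual classes of the
Birch–Swinnerton-Dyer formula for ALL analytic-rank `≤ 1` elliptic curves over `ℚ` — "full BSD
formula for every rank `≤ 1` curve in class `C`" assembled STRICTLY from published theorems — so
that the rank-`≤ 1` remainder becomes exactly the CONSTRUCTION-SHAPED classes, which are TYPED
(missing-input `Prop`s), NOT attempted. This is not "finishing BSD". Team n1011 (RESIDUAL-MAP §I
N10 / N11 LOWER, O8): research route; labels and marks UNCHANGED; nothing booked. Lead ruling R5-32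
(a) "TB-ROL": the per-pair binders `IsRamifiedOrdinaryLine W p L` of Route G's EPW consumers
(`Additive/CongruentPartnerMainConjectureGordEPW`, `AdditivePotMult/PotMultCongruentPartnerEPW`) are
to become THEOREMS; n1011-lit's verdict (LIT-INPUTS-P3 §28): NOT-A-FACT — everything needed is in
the tree. TWO definitions WITH BODIES (`twistMap`, `twistTransport`: Greenberg's own objects,
transported; no `Prop`-valued def, nothing asserted) and theorems; NO named fact; 0 debt.

## What

An additive potentially ordinary / potentially multiplicative curve `E = W` at the odd prime `p`
with semistability defect `e = 2` is a RAMIFIED quadratic twist `W ≅ V^{(c)}` (`ord_p c = 1`,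
`C • V.quadraticTwist c = W`) of a curve `V` that is good ordinary or multiplicative at `p`. The
canonical line `C_V ⊂ V[p^∞]` (Greenberg's `ker(E[p^∞] → Ẽ)`, LNM 1716 p. 63, or the Tate line
`μ_{p^∞}`, Greenberg–Vatsal p. 14; in the tree `X2.GreenbergVatsalReductionDatum.reductionDatum`,
`X2.GreenbergVatsalTateDatum.tateDatum`) has UNRAMIFIED quotient. Transporting it along the twist
isomorphism `t : V[p^∞](ℚ̄) ≃+ W[p^∞](ℚ̄)` — additive, and `Γ_ℚ`-SEMILINEAR for the quadratic
character `χ_c`: `t (g • m) = χ_c(g) • g • t m` (Silverman *AEC* X.2 Prop. 2.4 / X.5 Cor. 5.4; in the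
tree `psiQ`, `psiQ_smul`, `psiQ_smul_liftToAbsGal` of `BSDSelmerParityDokchitserBaseChangeProofs`,
composed with `primaryIso` of the change of variables `C`) — gives a `D_v`-stable line
`C_W = t(C_V) ⊂ W[p^∞]` whose quotient is `(V[p^∞]/C_V) ⊗ χ_c`: inertia acts on it through
`χ_c|_{I_p}`, of order EXACTLY `2` because `χ_c` is ramified at `p` (`ord_p c = 1`, `p` odd: an
inertia element moves `√c`, Kummer theory — the tree's
`exists_mem_absInertia_adicCompletion_smul_eq_pow_mul`). Hence `C_W` is a ramified ordinary line in
the sense of `EmertonPollackWeston2006.IsRamifiedOrdinaryLine` (divisible, `≠ ⊤`, `≠ ⊥`, inertia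
finite of exponent `n = 2` on the quotient, and non-trivial there).

* §1 `twistMap` — transport of a `GreenbergSelmer.LocalDatum` along a SIGN-semilinear additive
  isomorphism (`t (g • m) = ±(g • t m)`, the sign depending on `g` only); `mem_twistMap_plus_iff`.
* §2 `isRamifiedOrdinaryLine_twistMap` — over `ℚ`, `p ≠ 2`: divisible ∧ `≠ ⊤` ∧ `≠ ⊥` ∧ "the
  inertia group acts trivially on `V[p^∞]/C_V`" (the `htriv` shape of the X2 files) on the source,
  plus ONE local inertia element carrying the minus sign ⟹ `IsRamifiedOrdinaryLine W p (twistMap …)`.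
* §3 `twistTransport` — the concrete `t = primaryIso p hC ∘ (psiQ V K hθ hc p)⁻¹` for
  `C • V.quadraticTwist c = W` and `K = ℚ(θ)`, `θ² = c`; its sign rule (`+` on `galRange K`, `−` off
  it: `xor_galRange`), and the ramified inertia witness when `p ∈ v`, `ord_v c = 1`
  (`exists_mem_absInertia_twistTransport_smul_eq_neg`).
* §4 `isRamifiedOrdinaryLine_twistMap_twistTransport` — the assembly used by FILE B
  (`Additive/RamifiedOrdinaryLineGord`, `AdditivePotMult/RamifiedOrdinaryLinePotMult`).

Nothing here is specific to a class; no reduction hypothesis on `V` appears (it enters FILE B through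
the source datum). References: R. Greenberg, LNM 1716 (1999) §2 pp. 63, 69; R. Greenberg, V. Vatsal,
Invent. Math. 142 (2000) §2 p. 14; M. Emerton, R. Pollack, T. Weston, Invent. Math. 163 (2006) §3.1;
J. H. Silverman, *AEC* 2nd ed. X.2 Prop. 2.4, X.5 Cor. 5.4; T. Dokchitser, *Notes on the parity
conjecture* (2013) §4; J.-P. Serre, Invent. Math. 15 (1972) §1.3 (Kummer theory on inertia).
-/

noncomputable section

open scoped Classical NumberField

open NumberField IsDedekindDomain Field WeierstrassCurve
  Literature.NumberTheory.EllipticCurves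
  Literature.NumberTheory.EllipticCurves.GreenbergSelmer
  Literature.NumberTheory.EllipticCurves.EmertonPollackWeston2006
  Literature.NumberTheory.GaloisRepresentations

universe u

namespace Summit.BirchSwinnertonDyer.Rank1Residual.GaloisImage.RamifiedOrdinaryLineTwist

/-! ### §1 Transport of a local datum along a sign-semilinear additive isomorphism -/

section TwistMap

variable {K : Type u} [Field K] [NumberField K] {M M' : Type u} [AddCommGroup M] [AddCommGroup M']
  [DistribMulAction (absoluteGaloisGroup K) M] [DistribMulAction (absoluteGaloisGroup K) M']
  {v : HeightOneSpectrum (𝓞 K)}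

/-- **Transport of a Greenberg local datum along a sign-semilinear isomorphism.** For an additive
isomorphism `t : M ≃+ M'` of discrete `Γ_K`-modules with `t (g • m) = ±(g • t m)` (the sign depending
on `g` only — e.g. the twist isomorphism `E^{(c)}[p^∞] ≃ E[p^∞]`, semilinear for the quadratic
character of `K(√c)/K`, Silverman *AEC* X.5 Cor. 5.4), the image `t(M⁺_v)` of a `D_v`-stable subgroup
is again `D_v`-stable (a subgroup is closed under negation). Greenberg's `F⁺` transported; a
definition with a body, nothing asserted. [cite: Greenberg1989, §1 p. 98 (1)(b)]
[cite: SilvermanAEC2009, X.5 Cor. 5.4] -/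
def twistMap (L : LocalDatum K M v) (t : M ≃+ M')
    (ht : ∀ g : absoluteGaloisGroup K, (∀ m, t (g • m) = g • t m) ∨ (∀ m, t (g • m) = -(g • t m))) :
    LocalDatum K M' v where
  plus := L.plus.map t.toAddMonoidHom
  smul_mem σ {m'} hm' := by
    obtain ⟨m, hm, rfl⟩ := AddSubgroup.mem_map.1 hm'
    rw [AddEquiv.coe_toAddMonoidHom]
    rcases ht (absGaloisRestrict K (v.adicCompletion K) σ) with h | h
    · rw [← h m]
      exact AddSubgroup.mem_map.2 ⟨_, L.smul_mem σ hm, rfl⟩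
    · have h' : absGaloisRestrict K (v.adicCompletion K) σ • t m =
          t (-(absGaloisRestrict K (v.adicCompletion K) σ • m)) := by
        rw [map_neg, h m, neg_neg]
      rw [h']
      exact AddSubgroup.mem_map.2 ⟨_, L.plus.neg_mem (L.smul_mem σ hm), rfl⟩

/-- Membership in the transported datum: `m' ∈ t(M⁺_v) ↔ t⁻¹ m' ∈ M⁺_v`. [folklore] -/
theorem mem_twistMap_plus_iff (L : LocalDatum K M v) (t : M ≃+ M')
    (ht : ∀ g : absoluteGaloisGroup K, (∀ m, t (g • m) = g • t m) ∨ (∀ m, t (g • m) = -(g • t m)))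
    (m' : M') : m' ∈ (twistMap L t ht).plus ↔ t.symm m' ∈ L.plus := by
  change m' ∈ L.plus.map t.toAddMonoidHom ↔ _
  constructor
  · rintro ⟨m, hm, rfl⟩
    rw [AddEquiv.coe_toAddMonoidHom, AddEquiv.symm_apply_apply]
    exact hm
  · intro h
    exact ⟨t.symm m', h, by rw [AddEquiv.coe_toAddMonoidHom, AddEquiv.apply_symm_apply]⟩

/-- The image of a member of `M⁺_v` lies in the transported datum. [folklore] -/
theorem apply_mem_twistMap_plus_iff (L : LocalDatum K M v) (t : M ≃+ M')
    (ht : ∀ g : absoluteGaloisGroup K, (∀ m, t (g • m) = g • t m) ∨ (∀ m, t (g • m) = -(g • t m)))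
    (m : M) : t m ∈ (twistMap L t ht).plus ↔ m ∈ L.plus := by
  rw [mem_twistMap_plus_iff, AddEquiv.symm_apply_apply]

end TwistMap

/-! ### §2 The transported datum is a RAMIFIED ORDINARY LINE -/

section Line

variable {V W : WeierstrassCurve ℚ} {p : ℕ} [hp : Fact p.Prime] {v : HeightOneSpectrum (𝓞 ℚ)}

/-- At an odd prime `p`, a subgroup of `E[p^∞]` containing `2m` contains `m` (`p^k m = 0` with `p^k`
odd). [folklore] -/
theorem mem_of_two_nsmul_mem (hp2 : p ≠ 2) (X : AddSubgroup (V.geomPrimaryTorsion p))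
    {m : V.geomPrimaryTorsion p} (h : (2 : ℕ) • m ∈ X) : m ∈ X := by
  obtain ⟨k, hk⟩ := (AddCommGroup.mem_primaryComponent).1 m.2
  have hk' : p ^ k • m = 0 := Subtype.ext (by
    rw [AddSubmonoidClass.coe_nsmul, ZeroMemClass.coe_zero]; exact hk)
  obtain ⟨j, hj⟩ := (hp.out.odd_of_ne_two hp2).pow (n := k)
  have h1 : (j * 2 + 1) • m = 0 := by rw [mul_comm, ← hj]; exact hk'
  rw [add_nsmul, one_nsmul, mul_nsmul'] at h1
  rw [eq_neg_of_add_eq_zero_right h1]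
  exact X.neg_mem (X.nsmul_mem h j)

/-- **The transported line is a ramified ordinary line.** Let `t : V[p^∞] ≃+ W[p^∞]` be additive and
sign-semilinear (`t (g • m) = ±(g • t m)`), `p ≠ 2`, and let `C_V = L.plus ⊂ V[p^∞]` be a `D_v`-stable
subgroup which is divisible, proper, non-zero, with the inertia group `I_v` acting TRIVIALLY on
`V[p^∞]/C_V` (the `htriv` clause of the X2 Greenberg/Tate data: good ordinary or multiplicative `V`);
suppose ONE local inertia element `σ` carries the minus sign (`χ_c` ramified at `v`). Then
`C_W = t(C_V)` satisfies `EmertonPollackWeston2006.IsRamifiedOrdinaryLine W p`: divisibility and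
`≠ ⊤, ≠ ⊥` transport along `t`; for `σ ∈ I_v`, `σ²` acts on `W[p^∞]/C_W ≅ (V[p^∞]/C_V) ⊗ χ_c` trivially
(`χ_c² = 1`: exponent `n = 2`); and the given `σ` acts by `−1` on the quotient, moving every class
`m ∉ C_W` since the quotient has no `2`-torsion at odd `p`. This is EPW's `A'_{f̃,a}` for the twisted
branch (`a = (p−1)/2` when `V` is semistable at `p`), Greenberg LNM 1716 p. 69 / Coates LNM 1716
(62). [cite: EmertonPollackWeston2006, §3.1 (eq:ordes) (arXiv:math/0404484 p. 17)]
[cite: GreenbergLNM1716, §2 pp. 63, 69] [cite: SilvermanAEC2009, X.5 Cor. 5.4] -/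
theorem isRamifiedOrdinaryLine_twistMap (hp2 : p ≠ 2) (L : LocalDatum ℚ (V.geomPrimaryTorsion p) v)
    (t : V.geomPrimaryTorsion p ≃+ W.geomPrimaryTorsion p)
    (ht : ∀ g : absoluteGaloisGroup ℚ, (∀ m, t (g • m) = g • t m) ∨ (∀ m, t (g • m) = -(g • t m)))
    (hdiv : ∀ m ∈ L.plus, ∃ m₁ ∈ L.plus, p • m₁ = m) (htop : L.plus ≠ ⊤) (hbot : L.plus ≠ ⊥)
    (hunr : ∀ x ∈ inertia v, ∀ m : V.geomPrimaryTorsion p, x • m - m ∈ L.plus)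
    (hram : ∃ σ ∈ absInertia (v.adicCompletion ℚ), ∀ m : V.geomPrimaryTorsion p,
      t (absGaloisRestrict ℚ (v.adicCompletion ℚ) σ • m) =
        -(absGaloisRestrict ℚ (v.adicCompletion ℚ) σ • t m)) :
    IsRamifiedOrdinaryLine W p (twistMap L t ht) := by
  refine ⟨?_, ?_, ?_, ?_, ?_⟩
  · -- divisible
    intro m' hm'
    obtain ⟨m₁, hm₁, hpm₁⟩ := hdiv _ ((mem_twistMap_plus_iff L t ht m').1 hm')
    refine ⟨t m₁, (apply_mem_twistMap_plus_iff L t ht m₁).2 hm₁, ?_⟩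
    rw [← map_nsmul, hpm₁, AddEquiv.apply_symm_apply]
  · -- proper
    intro htop'
    apply htop
    rw [eq_top_iff]
    intro m _
    have h : t m ∈ (twistMap L t ht).plus := htop' ▸ AddSubgroup.mem_top _
    exact (apply_mem_twistMap_plus_iff L t ht m).1 h
  · -- non-zero
    intro hbot'
    apply hbot
    rw [eq_bot_iff]
    intro m hm
    have h : t m ∈ (twistMap L t ht).plus := (apply_mem_twistMap_plus_iff L t ht m).2 hm
    rw [hbot', AddSubgroup.mem_bot, EmbeddingLike.map_eq_zero_iff] at h
    rw [h]
    exact AddSubgroup.mem_bot.2 rfl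
  · -- inertia acts through a quotient of exponent 2
    refine ⟨2, two_pos, fun σ hσ m' ↦ ?_⟩
    set g := absGaloisRestrict ℚ (v.adicCompletion ℚ) σ with hg
    have hgI : g ∈ inertia v := Subgroup.mem_map.2 ⟨σ, hσ, rfl⟩
    obtain ⟨m, rfl⟩ : ∃ m, t m = m' := ⟨t.symm m', t.apply_symm_apply m'⟩
    have hsq : g ^ 2 • t m = t (g • g • m) := by
      rcases ht g with h | h
      · rw [pow_two, mul_smul, ← h m, ← h (g • m)]
      · rw [pow_two, mul_smul, show g • t m = -t (g • m) by rw [h m, neg_neg], smul_neg,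
          show g • t (g • m) = -t (g • g • m) by rw [h (g • m), neg_neg], neg_neg]
    rw [hsq, ← map_sub, apply_mem_twistMap_plus_iff]
    have h1 := hunr g hgI (g • m)
    have h2 := hunr g hgI m
    have h3 : g • g • m - m = (g • g • m - g • m) + (g • m - m) := by abel
    rw [h3]
    exact L.plus.add_mem h1 h2
  · -- and non-trivially
    obtain ⟨σ, hσ, hsgn⟩ := hram
    have key : ∀ g ∈ inertia v, (∀ m, t (g • m) = -(g • t m)) →
        ∃ m' : W.geomPrimaryTorsion p, g • m' - m' ∉ (twistMap L t ht).plus := by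
      intro g hgI hg
      obtain ⟨m₀, hm₀⟩ : ∃ m₀ : V.geomPrimaryTorsion p, m₀ ∉ L.plus := by
        by_contra h
        push Not at h
        exact htop (eq_top_iff.2 fun m _ ↦ h m)
      refine ⟨t m₀, fun hmem ↦ hm₀ ?_⟩
      have h1 : g • t m₀ - t m₀ = t (-(g • m₀ + m₀)) := by
        rw [map_neg, map_add, hg m₀]; abel
      rw [h1, apply_mem_twistMap_plus_iff, neg_mem_iff] at hmem
      have h2 : (2 : ℕ) • m₀ = (g • m₀ + m₀) - (g • m₀ - m₀) := by rw [two_nsmul]; abel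
      exact mem_of_two_nsmul_mem hp2 L.plus (h2 ▸ L.plus.sub_mem hmem (hunr g hgI m₀))
    obtain ⟨m', hm'⟩ := key _ (Subgroup.mem_map.2 ⟨σ, hσ, rfl⟩) hsgn
    exact ⟨σ, hσ, m', hm'⟩

end Line

/-! ### §3 The twist transport `t = primaryIso ∘ psiQ⁻¹ : V[p^∞] ≃+ W[p^∞]` and its sign rule -/

section Transport

variable (V : WeierstrassCurve ℚ) (K : Type) [Field K] [NumberField K]
  (h2 : Module.finrank ℚ K = 2) {θ : K} {c : ℚ} (hθ : θ ∉ Set.range (algebraMap ℚ K))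
  (hc : θ ^ 2 = algebraMap ℚ K c) (p : ℕ) {W : WeierstrassCurve ℚ} {C : VariableChange ℚ}
  (hC : C • V.quadraticTwist c = W)

/-- **The twist transport `V[p^∞](ℚ̄) ≃+ W[p^∞](ℚ̄)`** for `C • V^{(c)} = W` over `K = ℚ(θ)`,
`θ² = c`: the inverse of the tree's twist isomorphism `psiQ : V^{(c)}[p^∞] ≃+ V[p^∞]` (Silverman
*AEC* X.5 Cor. 5.4 over `K`, read on `ℚ̄`-points) followed by the change of variables `C`
(`primaryIso`). A definition with a body, nothing asserted. [cite: SilvermanAEC2009, X.5 Cor. 5.4] -/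
def twistTransport : V.geomPrimaryTorsion p ≃+ W.geomPrimaryTorsion p :=
  (psiQ V K hθ hc p).symm.trans (primaryIso p hC)

/-- Unfolding `twistTransport`. [folklore] -/
theorem twistTransport_apply (m : V.geomPrimaryTorsion p) :
    twistTransport V K hθ hc p hC m = primaryIso p hC ((psiQ V K hθ hc p).symm m) :=
  rfl

/-- `psiQ⁻¹` is `galRange K`-equivariant (from `psiQ_smul`). [folklore] -/
theorem psiQ_symm_smul_of_mem_galRange {g : absoluteGaloisGroup ℚ} (hg : g ∈ galRange (K := ℚ) K)
    (m : V.geomPrimaryTorsion p) :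
    (psiQ V K hθ hc p).symm (g • m) = g • (psiQ V K hθ hc p).symm m := by
  apply (psiQ V K hθ hc p).injective
  rw [AddEquiv.apply_symm_apply]
  have h := psiQ_smul V K hθ hc p ⟨g, hg⟩ ((psiQ V K hθ hc p).symm m)
  rw [AddEquiv.apply_symm_apply] at h
  exact h.symm

/-- `psiQ⁻¹` is anti-equivariant at the transported lift `c₀` of `σ₀` (from `psiQ_smul_liftToAbsGal`).
[cite: Dokchitser2013ParityNotes, §4] -/
theorem psiQ_symm_smul_liftToAbsGal (m : V.geomPrimaryTorsion p) :
    (psiQ V K hθ hc p).symm (liftToAbsGal (K := ℚ) K (sigmaQ K h2 hθ hc) • m) =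
      -(liftToAbsGal (K := ℚ) K (sigmaQ K h2 hθ hc) • (psiQ V K hθ hc p).symm m) := by
  apply (psiQ V K hθ hc p).injective
  rw [AddEquiv.apply_symm_apply, map_neg, psiQ_smul_liftToAbsGal, AddEquiv.apply_symm_apply,
    neg_neg]

/-- **Sign rule, `+`:** on `galRange K ≅ Γ_K` the twist transport is equivariant.
[cite: SilvermanAEC2009, X.5 Cor. 5.4] -/
theorem twistTransport_smul_of_mem_galRange {g : absoluteGaloisGroup ℚ}
    (hg : g ∈ galRange (K := ℚ) K) (m : V.geomPrimaryTorsion p) :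
    twistTransport V K hθ hc p hC (g • m) = g • twistTransport V K hθ hc p hC m := by
  rw [twistTransport_apply, twistTransport_apply, psiQ_symm_smul_of_mem_galRange V K hθ hc p hg,
    primaryIso_smul]

include h2 in
/-- **Sign rule, `−`:** off `galRange K` (the coset `galRange K · c₀`, `xor_galRange`) the twist
transport is ANTI-equivariant — "the Galois action on `E^{(c)}` is that on `E` twisted by the
quadratic character" (Silverman *AEC* X.2 Prop. 2.4; Dokchitser 2013 §4).
[cite: SilvermanAEC2009, X.5 Cor. 5.4] [cite: Dokchitser2013ParityNotes, §4] -/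
theorem twistTransport_smul_of_not_mem_galRange {g : absoluteGaloisGroup ℚ}
    (hg : g ∉ galRange (K := ℚ) K) (m : V.geomPrimaryTorsion p) :
    twistTransport V K hθ hc p hC (g • m) = -(g • twistTransport V K hθ hc p hC m) := by
  haveI : IsGalois ℚ K := isGalois_of_finrank_eq_two K h2
  set c₀ := liftToAbsGal (K := ℚ) K (sigmaQ K h2 hθ hc) with hc₀
  have hn : g * c₀⁻¹ ∈ galRange (K := ℚ) K := by
    rcases xor_galRange K h2 (sigmaQ_ne_one K h2 hθ hc) g with ⟨h, -⟩ | ⟨h, -⟩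
    · exact h
    · exact absurd h hg
  have hgeq : g = (g * c₀⁻¹) * c₀ := by rw [inv_mul_cancel_right]
  rw [twistTransport_apply, twistTransport_apply, hgeq, mul_smul,
    psiQ_symm_smul_of_mem_galRange V K hθ hc p hn, psiQ_symm_smul_liftToAbsGal V K h2 hθ hc p,
    smul_neg, map_neg, ← mul_smul, primaryIso_smul]

include h2 in
/-- **The sign rule** of the twist transport: for every `g ∈ Γ_ℚ`, `t (g • m) = g • t m` for all `m`
or `t (g • m) = -(g • t m)` for all `m`. [cite: SilvermanAEC2009, X.5 Cor. 5.4] -/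
theorem twistTransport_sign (g : absoluteGaloisGroup ℚ) :
    (∀ m, twistTransport V K hθ hc p hC (g • m) = g • twistTransport V K hθ hc p hC m) ∨
      (∀ m, twistTransport V K hθ hc p hC (g • m) = -(g • twistTransport V K hθ hc p hC m)) := by
  by_cases hg : g ∈ galRange (K := ℚ) K
  · exact Or.inl fun m ↦ twistTransport_smul_of_mem_galRange V K hθ hc p hC hg m
  · exact Or.inr fun m ↦ twistTransport_smul_of_not_mem_galRange V K h2 hθ hc p hC hg m

/-- An element of `Γ_ℚ` moving the copy `√c = j(θ) ∈ ℚ̄` of `θ` lies off `galRange K`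
(`smul_embIntoClosure_of_mem_galRange`). [folklore] -/
theorem not_mem_galRange_of_smul_embIntoClosure_ne {g : absoluteGaloisGroup ℚ}
    (h : g • embIntoClosure (K := ℚ) K θ ≠ embIntoClosure (K := ℚ) K θ) :
    g ∉ galRange (K := ℚ) K :=
  fun hg ↦ h (smul_embIntoClosure_of_mem_galRange K hg θ)

include hc in
/-- `j(θ)² = c` in `ℚ̄`. [folklore] -/
theorem embIntoClosure_sq : embIntoClosure (K := ℚ) K θ ^ 2 = algebraMap ℚ (AlgebraicClosure ℚ) c := by
  rw [← map_pow, hc, AlgHom.commutes]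
  simp only [eq_ratCast]

include h2 hc in
/-- **The ramified inertia witness.** If `p ∈ v`, `p ≠ 2` and `ord_v c = 1`
(`v.valuation ℚ c = exp (−1)`: `c = ±p`, `p*`, …), some element `σ` of the local inertia group
`I_{ℚ_v}` has `res σ • √c = -√c` (Kummer theory: `ℚ_v(√c)/ℚ_v` is ramified — the tree's
`exists_mem_absInertia_adicCompletion_smul_eq_pow_mul` with `n = 2`, `ζ = −1`), hence `res σ` lies
off `galRange ℚ(√c)` and the twist transport is ANTI-equivariant at `res σ`.
[cite: SerreInventiones1972, §1.3] [cite: SilvermanAEC2009, X.5 Cor. 5.4] -/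
theorem exists_mem_absInertia_twistTransport_smul_eq_neg [Fact p.Prime] (hp2 : p ≠ 2)
    {v : HeightOneSpectrum (𝓞 ℚ)} (hv : ((p : ℕ) : 𝓞 ℚ) ∈ v.asIdeal)
    (hval : v.valuation ℚ c = WithZero.exp (-1 : ℤ)) :
    ∃ σ ∈ absInertia (v.adicCompletion ℚ), ∀ m : V.geomPrimaryTorsion p,
      twistTransport V K hθ hc p hC (absGaloisRestrict ℚ (v.adicCompletion ℚ) σ • m) =
        -(absGaloisRestrict ℚ (v.adicCompletion ℚ) σ • twistTransport V K hθ hc p hC m) := by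
  have hζ : IsPrimitiveRoot (-1 : AlgebraicClosure ℚ) 2 := IsPrimitiveRoot.neg_one 0 (by decide)
  have h2v : ((2 : ℕ) : 𝓞 ℚ) ∉ v.asIdeal := by
    exact_mod_cast two_not_mem_of_natCast_prime_mem (Fact.out : p.Prime) hp2 hv
  obtain ⟨σ, hσ, hσθ⟩ := exists_mem_absInertia_adicCompletion_smul_eq_pow_mul ℚ v two_pos hζ h2v
    hval (embIntoClosure_sq K hc) 1
  refine ⟨σ, hσ, fun m ↦ twistTransport_smul_of_not_mem_galRange V K h2 hθ hc p hC
    (not_mem_galRange_of_smul_embIntoClosure_ne K (θ := θ) ?_) m⟩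
  rw [hσθ, pow_one, neg_one_mul]
  intro h
  have hθ0 : embIntoClosure (K := ℚ) K θ ≠ 0 := by
    intro h0
    apply Literature.NumberTheory.QuadraticFields.Quadratic.ne_zero_of_not_mem_range hθ
    exact (embIntoClosure (K := ℚ) K).injective (h0.trans (map_zero _).symm)
  have h2' : (2 : AlgebraicClosure ℚ) * embIntoClosure (K := ℚ) K θ = 0 := by linear_combination -h
  exact hθ0 ((mul_eq_zero.1 h2').resolve_left two_ne_zero)

end Transport

/-! ### §4 Assembly: a source datum with unramified quotient gives a ramified ordinary line on the twist -/

section Assembly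

variable (V : WeierstrassCurve ℚ) (K : Type) [Field K] [NumberField K]
  (h2 : Module.finrank ℚ K = 2) {θ : K} {c : ℚ} (hθ : θ ∉ Set.range (algebraMap ℚ K))
  (hc : θ ^ 2 = algebraMap ℚ K c) (p : ℕ) [Fact p.Prime] {W : WeierstrassCurve ℚ}
  {C : VariableChange ℚ} (hC : C • V.quadraticTwist c = W)

include h2 hc in
/-- **TB-ROL, generic form.** `C • V^{(c)} = W`, `K = ℚ(θ)` with `θ² = c`, `p ≠ 2`, `p ∈ v`,
`ord_v c = 1`; a `D_v`-stable `C_V ⊂ V[p^∞]` divisible, `≠ ⊤`, `≠ ⊥`, with `I_v` trivial on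
`V[p^∞]/C_V`. Then the transported datum `twistMap C_V t` along the twist transport `t` is a ramified
ordinary line of `W` at `v`: `IsRamifiedOrdinaryLine W p _`. FILE B feeds `C_V` = Greenberg's
reduction datum (good ordinary `V`) or the Tate datum (multiplicative `V`).
[cite: EmertonPollackWeston2006, §3.1 (eq:ordes) (arXiv:math/0404484 p. 17)]
[cite: GreenbergLNM1716, §2 pp. 63, 69] [cite: SilvermanAEC2009, X.5 Cor. 5.4] -/
theorem isRamifiedOrdinaryLine_twistMap_twistTransport (hp2 : p ≠ 2)
    {v : HeightOneSpectrum (𝓞 ℚ)} (hv : ((p : ℕ) : 𝓞 ℚ) ∈ v.asIdeal)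
    (hval : v.valuation ℚ c = WithZero.exp (-1 : ℤ))
    (L : LocalDatum ℚ (V.geomPrimaryTorsion p) v)
    (hdiv : ∀ m ∈ L.plus, ∃ m₁ ∈ L.plus, p • m₁ = m) (htop : L.plus ≠ ⊤) (hbot : L.plus ≠ ⊥)
    (hunr : ∀ x ∈ inertia v, ∀ m : V.geomPrimaryTorsion p, x • m - m ∈ L.plus) :
    IsRamifiedOrdinaryLine W p
      (twistMap L (twistTransport V K hθ hc p hC) (twistTransport_sign V K h2 hθ hc p hC)) :=
  isRamifiedOrdinaryLine_twistMap hp2 L _ _ hdiv htop hbot hunr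
    (exists_mem_absInertia_twistTransport_smul_eq_neg V K h2 hθ hc p hC hp2 hv hval)

include h2 hθ hc hC in
/-- **Existence form** (what the EPW consumers quantify over). [cite: EmertonPollackWeston2006, §3.1 (eq:ordes) (arXiv:math/0404484 p. 17)] -/
theorem exists_isRamifiedOrdinaryLine_of_twist (hp2 : p ≠ 2)
    {v : HeightOneSpectrum (𝓞 ℚ)} (hv : ((p : ℕ) : 𝓞 ℚ) ∈ v.asIdeal)
    (hval : v.valuation ℚ c = WithZero.exp (-1 : ℤ))
    (hL : ∃ L : LocalDatum ℚ (V.geomPrimaryTorsion p) v,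
      (∀ m ∈ L.plus, ∃ m₁ ∈ L.plus, p • m₁ = m) ∧ L.plus ≠ ⊤ ∧ L.plus ≠ ⊥ ∧
      (∀ x ∈ inertia v, ∀ m : V.geomPrimaryTorsion p, x • m - m ∈ L.plus)) :
    ∃ L' : LocalDatum ℚ (W.geomPrimaryTorsion p) v, IsRamifiedOrdinaryLine W p L' := by
  obtain ⟨L, hdiv, htop, hbot, hunr⟩ := hL
  exact ⟨_, isRamifiedOrdinaryLine_twistMap_twistTransport V K h2 hθ hc p hC hp2 hv hval L hdiv htop
    hbot hunr⟩

end Assembly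

end Summit.BirchSwinnertonDyer.Rank1Residual.GaloisImage.RamifiedOrdinaryLineTwist

end
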